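import Mathlib
import Summits.CriticalPhenomena.PercolationContinuityZ3.Theorems.PercNearOneGluingNoHeavyLowerTailOrientedAntipodalHallEnlargedTwoGroup
import Summits.CriticalPhenomena.PercolationContinuityZ3.Theorems.PercNearOneGluingNoHeavyLowerTailThreeFamilyTripleOrdered

/-!
# The oriented antipodal Hall count: petal enlargement with an ORDERED OUTER group (three groups)

Helper file for crux `stmt-CriticalPhenomena-4575` (`NoHeavyLowerTail`, route `PercNearOneGluingNoHeavy`),
new-inequality factory seat `prim-ineq-gen-3` (gen 12).  Everything here is PROVED.
Gen 11 left Conjecture O₄ open for exactly the four tournaments on four petals; each has a one-petal enlargement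
certificate whose OUTER group is ordered (memo FINDINGS-gen11.md F11-7), needing the 'ordered-outer TRIPLE⁻', now
`ThreeFamilyRank.triple0_minus_ordered` (gen 12).  This file is the label-calculus count built on it:
coordinates `𝒢 = {F : f F = B, f (S \ F) ∈ {A, C_τ}, F misses a bad}` for a petal `τ` that is never an `a`-label,
pseudo-class `𝒴 = {F ∈ 𝒢 : f (S \ F) = C_τ}`; groups `P = (members of D₁ with b = τ) ∪ 𝒴 ; (members of D₁ with
b ≠ τ)` (ordered outer, `D₁` complemented), `Q = D₂` (ordered middle: complemented before plain), `R = D₃`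
(complemented); the label conditions are those of `card_le_card_goods_above_of_ordered_assignment` plus
`¬ (a X = b Y ∧ b Y = b Z)` only for `b X = τ`, and `b Z ≠ a Y`; the conclusion counts the CO-GOODS `F` above a bad
(`f F = B`, `f (S \ F) = A`), in bijection with the goods by complementation.  Corollaries: the four tournaments
(file `…OrientedAntipodalHallTournaments`).  (prim-ineq-gen-3 gen 12, 2026-08-20.)
-/

namespace Summit.CriticalPhenomena.PercolationContinuityZ3.Theorems

namespace OrientedAntipodalHall

open Finset AntipodalStrongHarris AntipodalStrongHarris.Lab ThreeFamilyRank Module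
open scoped FinsetFamily

variable {α : Type*} [DecidableEq α] {k : ℕ}

/-- A label above a petal is that petal or `A`. -/
theorem eq_petal_or_eq_top_of_petal_le {σ : Fin k} {c : Lab k} (h : petal σ ≤ c) : c = petal σ ∨ c = top := by
  rw [le_def] at h
  rcases h with h | h | h
  · cases h
  · exact Or.inr h
  · exact Or.inl h.symm

/-- **The oriented antipodal Hall count from a three-group assignment with petal enlargement and an ordered OUTER
group.**  See the module docstring. -/
theorem card_le_card_goods_above_of_outer_ordered_assignment (S : Finset α) {f : Finset α → Lab k}
    (hf : ∀ ⦃X Y : Finset α⦄, X ⊆ Y → f X ≤ f Y) (D₁ D₂ D₃ : Finset (Finset α))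
    (cpl : Finset α → Bool) (a b : Finset α → Fin k) (τ : Fin k)
    (hlab : ∀ X ∈ D₁ ∪ D₂ ∪ D₃, X ⊆ S ∧ (cpl X = false → f X = petal (a X) ∧ f (S \ X) = petal (b X)) ∧
      (cpl X = true → f (S \ X) = petal (a X) ∧ f X = petal (b X)))
    (hτ : ∀ X ∈ D₁ ∪ D₂ ∪ D₃, a X ≠ τ)
    (hE₁ : ∀ X ∈ D₁, cpl X = true) (hE₃ : ∀ Z ∈ D₃, cpl Z = true)
    (hW₁ : ∀ X ∈ D₁, ∀ X' ∈ D₁, a X ≠ b X' ∧ b X ≠ a X')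
    (hW₂ : ∀ X ∈ D₂, ∀ X' ∈ D₂, a X ≠ b X' ∧ b X ≠ a X' ∧
      (cpl X = true → cpl X' = false → ¬ (a X = a X' ∧ b X = b X')))
    (hW₃ : ∀ X ∈ D₃, ∀ X' ∈ D₃, a X ≠ b X' ∧ b X ≠ a X')
    (hC₁₂ : ∀ X ∈ D₁, ∀ Y ∈ D₂, a X ≠ a Y ∧ b X ≠ b Y ∧ ¬ (a X = b Y ∧ a Y = b X))
    (hC₂₃ : ∀ Y ∈ D₂, ∀ Z ∈ D₃, a Y ≠ a Z ∧ b Y ≠ b Z ∧ ¬ (a Y = b Z ∧ a Z = b Y))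
    (hC₃₁ : ∀ Z ∈ D₃, ∀ X ∈ D₁, a Z ≠ a X ∧ b Z ≠ b X ∧ ¬ (a Z = b X ∧ a X = b Z))
    (hDD₁ : ∀ X ∈ D₁, ∀ Y ∈ D₂, ∀ Z ∈ D₃, b X = τ → ¬ (a X = b Y ∧ b Y = b Z))
    (hDD₃ : ∀ X ∈ D₁, ∀ Y ∈ D₂, ∀ Z ∈ D₃, ¬ (a Z = b X ∧ b X = b Y) ∧ ¬ (b Z = a X ∧ a X = a Y))
    (hτ₃ : ∀ Y ∈ D₂, ∀ Z ∈ D₃, b Z ≠ a Y) :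
    #D₁ + #D₂ + #D₃ ≤
      #{F ∈ S.powerset | f F = bot ∧ f (S \ F) = top ∧ ∃ X ∈ D₁ ∪ D₂ ∪ D₃, X ⊆ S \ F} := by
  -- the member of a bad and its labels
  set M : Finset α → Finset α := fun X => if cpl X = true then S \ X else X with hMdef
  have mem₁ : ∀ X ∈ D₁, X ∈ D₁ ∪ D₂ ∪ D₃ := fun X hX => mem_union_left _ (mem_union_left _ hX)
  have mem₂ : ∀ Y ∈ D₂, Y ∈ D₁ ∪ D₂ ∪ D₃ := fun Y hY => mem_union_left _ (mem_union_right _ hY)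
  have mem₃ : ∀ Z ∈ D₃, Z ∈ D₁ ∪ D₂ ∪ D₃ := fun Z hZ => mem_union_right _ hZ
  have hXS : ∀ X ∈ D₁ ∪ D₂ ∪ D₃, X ⊆ S := fun X hX => (hlab X hX).1
  have hMS : ∀ X ∈ D₁ ∪ D₂ ∪ D₃, M X ⊆ S := fun X hX => by
    simp only [hMdef]; split_ifs; exacts [sdiff_subset, hXS X hX]
  have hMa : ∀ X ∈ D₁ ∪ D₂ ∪ D₃, f (M X) = petal (a X) := by
    intro X hX; simp only [hMdef]
    by_cases hc : cpl X = true
    · rw [if_pos hc]; exact ((hlab X hX).2.2 hc).1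
    · rw [if_neg hc]; exact ((hlab X hX).2.1 (by simpa using hc)).1
  have hMb : ∀ X ∈ D₁ ∪ D₂ ∪ D₃, f (S \ M X) = petal (b X) := by
    intro X hX; simp only [hMdef]
    by_cases hc : cpl X = true
    · rw [if_pos hc, Finset.sdiff_sdiff_eq_self (hXS X hX)]; exact ((hlab X hX).2.2 hc).2
    · rw [if_neg hc]; exact ((hlab X hX).2.1 (by simpa using hc)).2
  have hMc : ∀ X ∈ D₁ ∪ D₂ ∪ D₃, cpl X = true → M X = S \ X := fun X _ hc => by simp only [hMdef, if_pos hc]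
  have hlabel_of_subset : ∀ X ∈ D₁ ∪ D₂ ∪ D₃, ∀ X' ∈ D₁ ∪ D₂ ∪ D₃, M X ⊆ M X' → a X = a X' ∧ b X = b X' :=
    fun X hX X' hX' hsub => ⟨eq_of_petal_le_petal (by rw [← hMa X hX, ← hMa X' hX']; exact hf hsub),
      (eq_of_petal_le_petal (by rw [← hMb X' hX', ← hMb X hX]; exact hf (sdiff_subset_sdiff le_rfl hsub))).symm⟩
  have below : ∀ {X F : Finset α}, X ⊆ S → F ⊆ S \ X → X ⊆ S \ F :=
    fun hXS hF => subset_sdiff_of_subset_sdiff' hXS hF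
  have badM : ∀ X ∈ D₁ ∪ D₂ ∪ D₃, cpl X = true → ∀ {F : Finset α}, F ⊆ M X → X ⊆ S \ F := by
    intro X hX hc F hF; rw [hMc X hX hc] at hF; exact below (hXS X hX) hF
  have badM' : ∀ X ∈ D₁ ∪ D₂ ∪ D₃, cpl X = false → ∀ {F : Finset α}, F ⊆ S \ M X → X ⊆ S \ F := by
    intro X hX hc F hF
    have hc' : ¬ cpl X = true := by simp [hc]
    simp only [hMdef, if_neg hc'] at hF; exact below (hXS X hX) hF
  -- the enlarged coordinates: `f F = B`, `f (S \ F) ∈ {A, C_τ}`, `F` misses a bad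
  set 𝒢 : Finset (Finset α) := {F ∈ S.powerset | f F = bot ∧ (f (S \ F) = top ∨ f (S \ F) = petal τ) ∧
    ∃ X ∈ D₁ ∪ D₂ ∪ D₃, X ⊆ S \ F} with h𝒢
  have h𝒢S : ∀ E ∈ 𝒢, E ⊆ S := fun E hE => by rw [h𝒢, mem_filter, mem_powerset] at hE; exact hE.1
  have up_of_petal : ∀ {T T' : Finset α}, T ⊆ T' → (f T = top ∨ f T = petal τ) →
      (f T' = top ∨ f T' = petal τ) := fun hTT' h => by
    rcases h with h | h
    exacts [Or.inl (eq_top_of_top_le (by rw [← h]; exact hf hTT')),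
      (eq_petal_or_eq_top_of_petal_le (by rw [← h]; exact hf hTT')).symm]
  have h𝒢down : ∀ E ∈ 𝒢, ∀ F, F ⊆ E → F ∈ 𝒢 := by
    intro E hE F hFE
    rw [h𝒢, mem_filter, mem_powerset] at hE ⊢
    obtain ⟨hES, hbot, hup, X, hX, hXE⟩ := hE
    exact ⟨hFE.trans hES, eq_bot_of_le_bot (by rw [← hbot]; exact hf hFE),
      up_of_petal (sdiff_subset_sdiff le_rfl hFE) hup, X, hX, hXE.trans (sdiff_subset_sdiff le_rfl hFE)⟩
  -- certification: two petal witnesses above `F` (different), and below `S \ F` either two different petals or `τ`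
  have cert : ∀ {F U₁ U₂ V₁ V₂ : Finset α} {p q r s : Fin k}, F ⊆ S → p ≠ q → r ≠ s →
      f U₁ = petal p → f U₂ = petal q → U₁ ⊆ S \ F → U₂ ⊆ S \ F →
      f V₁ = petal r → f V₂ = petal s → F ⊆ V₁ → F ⊆ V₂ →
      (∃ X ∈ D₁ ∪ D₂ ∪ D₃, X ⊆ S \ F) → F ∈ 𝒢 := by
    intro F U₁ U₂ V₁ V₂ p q r s hFS hpq hrs hU₁ hU₂ h₁ h₂ hV₁ hV₂ h₃ h₄ hX
    obtain ⟨htop, hbot⟩ := good_sdiff_of_witnesses S hf hFS hpq hrs hU₁ hU₂ h₁ h₂ hV₁ hV₂ h₃ h₄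
    rw [Finset.sdiff_sdiff_eq_self hFS] at hbot
    rw [h𝒢, mem_filter, mem_powerset]; exact ⟨hFS, hbot, Or.inl htop, hX⟩
  have certτ : ∀ {F U V₁ V₂ : Finset α} {r s : Fin k}, F ⊆ S → r ≠ s → f U = petal τ → U ⊆ S \ F →
      f V₁ = petal r → f V₂ = petal s → F ⊆ V₁ → F ⊆ V₂ → (∃ X ∈ D₁ ∪ D₂ ∪ D₃, X ⊆ S \ F) → F ∈ 𝒢 := by
    intro F U V₁ V₂ r s hFS hrs hU hU₁ hV₁ hV₂ h₃ h₄ hX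
    rw [h𝒢, mem_filter, mem_powerset]
    refine ⟨hFS, eq_bot_of_le_petal hrs (by rw [← hV₁]; exact hf h₃) (by rw [← hV₂]; exact hf h₄),
      (eq_petal_or_eq_top_of_petal_le (by rw [← hU]; exact hf hU₁)).symm, hX⟩
  have cert₃ : ∀ {F U₁ U₂ U₃ V₁ V₂ V₃ : Finset α} {p q r x y z : Fin k}, F ⊆ S → ¬ (p = q ∧ q = r) →
      ¬ (x = y ∧ y = z) → f U₁ = petal p → f U₂ = petal q → f U₃ = petal r →
      U₁ ⊆ S \ F → U₂ ⊆ S \ F → U₃ ⊆ S \ F →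
      f V₁ = petal x → f V₂ = petal y → f V₃ = petal z → F ⊆ V₁ → F ⊆ V₂ → F ⊆ V₃ →
      (∃ X ∈ D₁ ∪ D₂ ∪ D₃, X ⊆ S \ F) → F ∈ 𝒢 := by
    intro F U₁ U₂ U₃ V₁ V₂ V₃ p q r x y z hFS hpqr hxyz hU₁ hU₂ hU₃ h₁ h₂ h₃ hV₁ hV₂ hV₃ h₄ h₅ h₆ hX
    rw [h𝒢, mem_filter, mem_powerset]
    exact ⟨hFS, eq_bot_of_le_three hxyz (by rw [← hV₁]; exact hf h₄) (by rw [← hV₂]; exact hf h₅)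
      (by rw [← hV₃]; exact hf h₆), Or.inl (eq_top_of_three_le hpqr (by rw [← hU₁]; exact hf h₁)
      (by rw [← hU₂]; exact hf h₂) (by rw [← hU₃]; exact hf h₃)), hX⟩
  -- a single difference `M X \ M X'` (certified when `X` is complemented or `X'` is plain)
  have hdiff : ∀ X ∈ D₁ ∪ D₂ ∪ D₃, ∀ X' ∈ D₁ ∪ D₂ ∪ D₃, a X ≠ b X' → b X ≠ a X' →
      (cpl X = true ∨ cpl X' = false) → M X \ M X' ∈ 𝒢 := by
    intro X hX X' hX' hab hba hc
    have hF1 : M X \ M X' ⊆ M X := sdiff_subset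
    have hF2 : M X \ M X' ⊆ S \ M X' := sdiff_subset_sdiff (hMS X hX) le_rfl
    refine cert (hF1.trans (hMS X hX)) hba hab (hMb X hX) (hMa X' hX') (sdiff_subset_sdiff le_rfl hF1)
      (below (hMS X' hX') hF2) (hMa X hX) (hMb X' hX') hF1 hF2 ?_
    rcases hc with hc | hc
    exacts [⟨X, hX, badM X hX hc hF1⟩, ⟨X', hX', badM' X' hX' hc hF2⟩]
  have hWblock : ∀ D : Finset (Finset α), (∀ X ∈ D, X ∈ D₁ ∪ D₂ ∪ D₃) →
      (∀ X ∈ D, ∀ X' ∈ D, cpl X = cpl X' ∧ a X ≠ b X' ∧ b X ≠ a X') →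
      ∀ U ∈ D.image M, ∀ U' ∈ D.image M, U \ U' ∈ 𝒢 := by
    intro D hD hW U hU U' hU'
    obtain ⟨X, hX, rfl⟩ := mem_image.mp hU
    obtain ⟨X', hX', rfl⟩ := mem_image.mp hU'
    obtain ⟨hcc, hab, hba⟩ := hW X hX X' hX'
    refine hdiff X (hD X hX) X' (hD X' hX') hab hba ?_
    by_cases hc : cpl X = true
    exacts [Or.inl hc, Or.inr (by rw [← hcc]; simpa using hc)]
  -- cross meets
  have hmeet_ne : ∀ X ∈ D₁ ∪ D₂ ∪ D₃, ∀ Y ∈ D₁ ∪ D₂ ∪ D₃, ¬ (a X = b Y ∧ a Y = b X) → (M X ∩ M Y).Nonempty := by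
    intro X hX3 Y hY3 hnopp
    rw [nonempty_iff_ne_empty]
    intro he
    have aux : ∀ {T T' : Finset α}, T ⊆ S → T ∩ T' = ∅ → T ⊆ S \ T' := fun hT h x hx =>
      mem_sdiff.mpr ⟨hT hx, fun hx' => by simpa [h] using (mem_inter.mpr ⟨hx, hx'⟩ : x ∈ _ ∩ _)⟩
    exact hnopp ⟨eq_of_petal_le_petal (by rw [← hMa X hX3, ← hMb Y hY3]; exact hf (aux (hMS X hX3) he)),
      eq_of_petal_le_petal (by
        rw [← hMa Y hY3, ← hMb X hX3]; exact hf (aux (hMS Y hY3) (by rwa [inter_comm] at he)))⟩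
  have hCblock : ∀ Dₛ Dₜ : Finset (Finset α), (∀ X ∈ Dₛ, X ∈ D₁ ∪ D₂ ∪ D₃) → (∀ Y ∈ Dₜ, Y ∈ D₁ ∪ D₂ ∪ D₃) →
      (∀ X ∈ Dₛ, ∀ Y ∈ Dₜ, a X ≠ a Y ∧ b X ≠ b Y ∧ (cpl X = true ∨ cpl Y = true) ∧ ¬ (a X = b Y ∧ a Y = b X)) →
      ∀ U ∈ Dₛ.image M, ∀ U' ∈ Dₜ.image M, U ∩ U' ∈ 𝒢 ∧ (U ∩ U').Nonempty := by
    intro Dₛ Dₜ hDₛ hDₜ hC U hU U' hU'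
    obtain ⟨X, hX, rfl⟩ := mem_image.mp hU
    obtain ⟨Y, hY, rfl⟩ := mem_image.mp hU'
    obtain ⟨haa, hbb, hcpl, hnopp⟩ := hC X hX Y hY
    have hX3 := hDₛ X hX; have hY3 := hDₜ Y hY
    have hF1 : M X ∩ M Y ⊆ M X := inter_subset_left
    have hF2 : M X ∩ M Y ⊆ M Y := inter_subset_right
    refine ⟨cert (hF1.trans (hMS X hX3)) hbb haa (hMb X hX3) (hMb Y hY3) (sdiff_subset_sdiff le_rfl hF1)
      (sdiff_subset_sdiff le_rfl hF2) (hMa X hX3) (hMa Y hY3) hF1 hF2 ?_, hmeet_ne X hX3 Y hY3 hnopp⟩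
    rcases hcpl with hc | hc
    exacts [⟨X, hX3, badM X hX3 hc hF1⟩, ⟨Y, hY3, badM Y hY3 hc hF2⟩]
  have dd_sub : ∀ {A B C : Finset α}, A ⊆ S →
      A \ (B ∪ C) ⊆ A ∧ A \ (B ∪ C) ⊆ S \ B ∧ A \ (B ∪ C) ⊆ S \ C := fun hAS =>
    ⟨sdiff_subset, fun x hx => mem_sdiff.mpr ⟨hAS (mem_sdiff.mp hx).1, fun h => (mem_sdiff.mp hx).2
      (mem_union_left _ h)⟩, fun x hx => mem_sdiff.mpr ⟨hAS (mem_sdiff.mp hx).1, fun h => (mem_sdiff.mp hx).2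
      (mem_union_right _ h)⟩⟩
  -- the families
  set D₁e : Finset (Finset α) := D₁.filter (fun X => b X = τ) with hD₁e
  set D₁l : Finset (Finset α) := D₁.filter (fun X => b X ≠ τ) with hD₁l
  set 𝒴 : Finset (Finset α) := 𝒢.filter (fun F => f (S \ F) ≠ top) with h𝒴def
  set K₀ : Finset (Finset α) := 𝒢.filter (fun F => f (S \ F) = top) with hK₀def
  set P₁ : Finset (Finset α) := D₁e.image M ∪ 𝒴 with hP₁def
  set P₂ : Finset (Finset α) := D₁l.image M with hP₂def
  set D₂c : Finset (Finset α) := D₂.filter (fun X => cpl X = true) with hD₂c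
  set D₂p : Finset (Finset α) := D₂.filter (fun X => cpl X = false) with hD₂p
  set Q₁ : Finset (Finset α) := D₂c.image M with hQ₁def
  set Q₂ : Finset (Finset α) := D₂p.image M with hQ₂def
  set R : Finset (Finset α) := D₃.image M with hRdef
  have hD₁e_sub : ∀ X ∈ D₁e, X ∈ D₁ := fun X hX => (mem_filter.mp hX).1
  have hD₁l_sub : ∀ X ∈ D₁l, X ∈ D₁ := fun X hX => (mem_filter.mp hX).1
  have hD₂c_sub : ∀ X ∈ D₂c, X ∈ D₂ := fun X hX => (mem_filter.mp hX).1
  have hD₂p_sub : ∀ X ∈ D₂p, X ∈ D₂ := fun X hX => (mem_filter.mp hX).1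
  have hD₁split : D₁ = D₁e ∪ D₁l := by rw [hD₁e, hD₁l]; exact (filter_union_filter_not_eq _ _).symm
  have hD₂split : D₂ = D₂c ∪ D₂p := by
    ext X; simp only [hD₂c, hD₂p, mem_union, mem_filter]
    refine ⟨fun hX => ?_, fun h => h.elim (fun h => h.1) (fun h => h.1)⟩
    by_cases hc : cpl X = true
    exacts [Or.inl ⟨hX, hc⟩, Or.inr ⟨hX, by simpa using hc⟩]
  have hPeq : D₁.image M ∪ 𝒴 = P₁ ∪ P₂ := by
    rw [hP₁def, hP₂def, hD₁split, image_union]; ac_rfl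
  have hQeq : D₂.image M = Q₁ ∪ Q₂ := by rw [hQ₁def, hQ₂def, ← image_union, ← hD₂split]
  -- the pseudo-class
  have h𝒴 : ∀ y ∈ 𝒴, y ∈ 𝒢 ∧ y ⊆ S ∧ f y = bot ∧ f (S \ y) = petal τ := by
    intro y hy
    obtain ⟨hy𝒢, hne⟩ := mem_filter.mp hy
    have hy' := hy𝒢; rw [h𝒢, mem_filter, mem_powerset] at hy'
    obtain ⟨hyS, hbot, hup, -⟩ := hy'
    rcases hup with h | h; exacts [absurd h hne, ⟨hy𝒢, hyS, hbot, h⟩]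
  have hy_meet : ∀ y ∈ 𝒴, ∀ X ∈ D₁ ∪ D₂ ∪ D₃, y ∩ M X ∈ 𝒢 ∧ (y ∩ M X).Nonempty := by
    intro y hy X hX
    obtain ⟨hy𝒢, hyS, -, hyτ⟩ := h𝒴 y hy
    refine ⟨h𝒢down y hy𝒢 _ inter_subset_left, ?_⟩
    rw [nonempty_iff_ne_empty]
    intro he
    have hsub : M X ⊆ S \ y := fun x hx => mem_sdiff.mpr ⟨hMS X hX hx, fun hxy => by
      simpa [he] using (mem_inter.mpr ⟨hxy, hx⟩ : x ∈ y ∩ M X)⟩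
    exact hτ X hX (eq_of_petal_le_petal (by rw [← hMa X hX, ← hyτ]; exact hf hsub))
  have hy_not_sub : ∀ y ∈ 𝒴, ∀ X ∈ D₁ ∪ D₂ ∪ D₃, b X ≠ τ → ¬ y ⊆ M X := fun y hy X hX hb hsub =>
    hb (eq_of_petal_le_petal (by
      rw [← hMb X hX, ← (h𝒴 y hy).2.2.2]; exact hf (sdiff_subset_sdiff le_rfl hsub)))
  -- `M X \ y` for a complemented `X` with `b X = τ`
  have hMy : ∀ X ∈ D₁ ∪ D₂ ∪ D₃, cpl X = true → b X = τ → ∀ y ∈ 𝒴, M X \ y ∈ 𝒢 := by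
    intro X hX hc hb y hy
    obtain ⟨-, hyS, -, hyτ⟩ := h𝒴 y hy
    have hF1 : M X \ y ⊆ M X := sdiff_subset
    refine certτ (hF1.trans (hMS X hX)) (hτ X hX) (by rw [hMb X hX, hb]) (sdiff_subset_sdiff le_rfl hF1)
      (hMa X hX) hyτ hF1 (sdiff_subset_sdiff (hMS X hX) le_rfl) ⟨X, hX, badM X hX hc hF1⟩
  -- group one (rank 0 ∪ pseudo-class): all differences
  have hP₁₁ : ∀ U ∈ P₁, ∀ U' ∈ P₁, U \ U' ∈ 𝒢 := by
    intro U hU U' hU'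
    rcases mem_union.mp hU with hU | hU
    · obtain ⟨X, hX, rfl⟩ := mem_image.mp hU
      have hX1 := hD₁e_sub X hX; have hX3 := mem₁ X hX1
      rcases mem_union.mp hU' with hU' | hU'
      · obtain ⟨X', hX', rfl⟩ := mem_image.mp hU'
        obtain ⟨hab, hba⟩ := hW₁ X hX1 X' (hD₁e_sub X' hX')
        exact hdiff X hX3 X' (mem₁ X' (hD₁e_sub X' hX')) hab hba (Or.inl (hE₁ X hX1))
      · exact hMy X hX3 (hE₁ X hX1) (mem_filter.mp hX).2 U' hU'
    · exact h𝒢down U (h𝒴 U hU).1 _ sdiff_subset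
  have hP₂₂ : ∀ U ∈ P₂, ∀ U' ∈ P₂, U \ U' ∈ 𝒢 :=
    hWblock D₁l (fun X hX => mem₁ X (hD₁l_sub X hX)) (fun X hX X' hX' =>
      ⟨by rw [hE₁ X (hD₁l_sub X hX), hE₁ X' (hD₁l_sub X' hX')], hW₁ X (hD₁l_sub X hX) X' (hD₁l_sub X' hX')⟩)
  have hP₁₂ : ∀ U ∈ P₁, ∀ U' ∈ P₂, U \ U' ∈ 𝒢 ∧ ¬ U ⊆ U' := by
    intro U hU U' hU'
    obtain ⟨X', hX', rfl⟩ := mem_image.mp hU'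
    have hX'1 := hD₁l_sub X' hX'; have hX'3 := mem₁ X' hX'1
    have hb' : b X' ≠ τ := (mem_filter.mp hX').2
    rcases mem_union.mp hU with hU | hU
    · obtain ⟨X, hX, rfl⟩ := mem_image.mp hU
      have hX1 := hD₁e_sub X hX; have hX3 := mem₁ X hX1
      obtain ⟨hab, hba⟩ := hW₁ X hX1 X' hX'1
      refine ⟨hdiff X hX3 X' hX'3 hab hba (Or.inl (hE₁ X hX1)), fun hsub => hb' ?_⟩
      rw [← (hlabel_of_subset X hX3 X' hX'3 hsub).2]; exact (mem_filter.mp hX).2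
    · exact ⟨h𝒢down U (h𝒴 U hU).1 _ sdiff_subset, hy_not_sub U hU X' hX'3 hb'⟩
  -- the middle group (ordered by the bit)
  have hQ₁₁ : ∀ U ∈ Q₁, ∀ U' ∈ Q₁, U \ U' ∈ 𝒢 :=
    hWblock D₂c (fun X hX => mem₂ X (hD₂c_sub X hX)) (fun X hX X' hX' => by
      obtain ⟨hab, hba, -⟩ := hW₂ X (hD₂c_sub X hX) X' (hD₂c_sub X' hX')
      exact ⟨by rw [(mem_filter.mp hX).2, (mem_filter.mp hX').2], hab, hba⟩)
  have hQ₂₂ : ∀ U ∈ Q₂, ∀ U' ∈ Q₂, U \ U' ∈ 𝒢 :=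
    hWblock D₂p (fun X hX => mem₂ X (hD₂p_sub X hX)) (fun X hX X' hX' => by
      obtain ⟨hab, hba, -⟩ := hW₂ X (hD₂p_sub X hX) X' (hD₂p_sub X' hX')
      exact ⟨by rw [(mem_filter.mp hX).2, (mem_filter.mp hX').2], hab, hba⟩)
  have hQ₁₂ : ∀ U ∈ Q₁, ∀ U' ∈ Q₂, U \ U' ∈ 𝒢 ∧ ¬ U ⊆ U' := by
    intro U hU U' hU'
    obtain ⟨X, hX, rfl⟩ := mem_image.mp hU
    obtain ⟨X', hX', rfl⟩ := mem_image.mp hU'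
    have hc : cpl X = true := (mem_filter.mp hX).2
    have hc' : cpl X' = false := (mem_filter.mp hX').2
    have hX2 := hD₂c_sub X hX; have hX'2 := hD₂p_sub X' hX'
    obtain ⟨hab, hba, hne⟩ := hW₂ X hX2 X' hX'2
    exact ⟨hdiff X (mem₂ X hX2) X' (mem₂ X' hX'2) hab hba (Or.inl hc),
      fun hsub => hne hc hc' (hlabel_of_subset X (mem₂ X hX2) X' (mem₂ X' hX'2) hsub)⟩
  have hRR : ∀ U ∈ R, ∀ U' ∈ R, U \ U' ∈ 𝒢 :=
    hWblock D₃ mem₃ (fun Z hZ Z' hZ' => ⟨by rw [hE₃ Z hZ, hE₃ Z' hZ'], hW₃ Z hZ Z' hZ'⟩)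
  have hRP₂ : ∀ U ∈ R, ∀ U' ∈ P₂, ¬ U ⊆ U' := by
    intro U hU U' hU' hsub
    obtain ⟨Z, hZ, rfl⟩ := mem_image.mp hU
    obtain ⟨X, hX, rfl⟩ := mem_image.mp hU'
    exact (hC₃₁ Z hZ X (hD₁l_sub X hX)).1 (hlabel_of_subset Z (mem₃ Z hZ) X (mem₁ X (hD₁l_sub X hX)) hsub).1
  -- cross meets
  have tri : ∀ {D D' : Finset (Finset α)} {c : Finset α → Prop},
      (∀ X ∈ D, ∀ Y ∈ D', a X ≠ a Y ∧ b X ≠ b Y ∧ ¬ (a X = b Y ∧ a Y = b X)) → (∀ X ∈ D, ∀ Y ∈ D', c X ∨ c Y) →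
      ∀ X ∈ D, ∀ Y ∈ D', a X ≠ a Y ∧ b X ≠ b Y ∧ (c X ∨ c Y) ∧ ¬ (a X = b Y ∧ a Y = b X) :=
    fun h hc X hX Y hY => ⟨(h X hX Y hY).1, (h X hX Y hY).2.1, hc X hX Y hY, (h X hX Y hY).2.2⟩
  have hC₁₂' := tri (c := fun X => cpl X = true) hC₁₂ (fun X hX _ _ => Or.inl (hE₁ X hX))
  have hC₂₃' := tri (c := fun X => cpl X = true) hC₂₃ (fun _ _ Z hZ => Or.inr (hE₃ Z hZ))
  have hC₃₁' := tri (c := fun X => cpl X = true) hC₃₁ (fun Z hZ _ _ => Or.inl (hE₃ Z hZ))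
  have hPQ : ∀ U ∈ P₁ ∪ P₂, ∀ U' ∈ Q₁ ∪ Q₂, U ∩ U' ∈ 𝒢 ∧ (U ∩ U').Nonempty := by
    intro U hU U' hU'
    rw [← hPeq] at hU; rw [← hQeq] at hU'
    rcases mem_union.mp hU with hU | hU
    · exact hCblock D₁ D₂ mem₁ mem₂ hC₁₂' U hU U' hU'
    · obtain ⟨Y, hY, rfl⟩ := mem_image.mp hU'
      exact hy_meet U hU Y (mem₂ Y hY)
  have hQR : ∀ U ∈ Q₁ ∪ Q₂, ∀ U' ∈ R, U ∩ U' ∈ 𝒢 ∧ (U ∩ U').Nonempty := fun U hU U' hU' =>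
    hCblock D₂ D₃ mem₂ mem₃ hC₂₃' U (hQeq ▸ hU) U' hU'
  have hRP : ∀ U ∈ R, ∀ U' ∈ P₁ ∪ P₂, U ∩ U' ∈ 𝒢 ∧ (U ∩ U').Nonempty := by
    intro U hU U' hU'
    rw [← hPeq] at hU'
    rcases mem_union.mp hU' with hU' | hU'
    · exact hCblock D₃ D₁ mem₃ mem₁ hC₃₁' U hU U' hU'
    · obtain ⟨Z, hZ, rfl⟩ := mem_image.mp hU
      rw [inter_comm]; exact hy_meet U' hU' Z (mem₃ Z hZ)
  -- the double differences
  have hDDP : ∀ U ∈ P₁, ∀ U' ∈ Q₁ ∪ Q₂, ∀ U'' ∈ R, U \ (U' ∪ U'') ∈ 𝒢 := by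
    intro U hU U' hU' U'' hU''
    rw [← hQeq] at hU'
    obtain ⟨Y, hY, rfl⟩ := mem_image.mp hU'
    obtain ⟨Z, hZ, rfl⟩ := mem_image.mp hU''
    have hY3 := mem₂ Y hY; have hZ3 := mem₃ Z hZ
    rcases mem_union.mp hU with hU | hU
    · obtain ⟨X, hX, rfl⟩ := mem_image.mp hU
      have hX1 := hD₁e_sub X hX; have hX3 := mem₁ X hX1
      have hb : b X = τ := (mem_filter.mp hX).2
      obtain ⟨hFX, hFY, hFZ⟩ := dd_sub (B := M Y) (C := M Z) (hMS X hX3)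
      rw [h𝒢, mem_filter, mem_powerset]
      refine ⟨hFX.trans (hMS X hX3), eq_bot_of_le_three (hDD₁ X hX1 Y hY Z hZ hb) (by rw [← hMa X hX3]; exact hf hFX)
        (by rw [← hMb Y hY3]; exact hf hFY) (by rw [← hMb Z hZ3]; exact hf hFZ), ?_, X, hX3, badM X hX3 (hE₁ X hX1) hFX⟩
      exact up_of_petal (sdiff_subset_sdiff le_rfl hFX) (Or.inr (by rw [hMb X hX3, hb]))
    · exact h𝒢down U (h𝒴 U hU).1 _ sdiff_subset
  have hDDR : ∀ U ∈ P₁ ∪ P₂, ∀ U' ∈ Q₁ ∪ Q₂, ∀ U'' ∈ R, U'' \ (U ∪ U') ∈ 𝒢 := by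
    intro U hU U' hU' U'' hU''
    rw [← hQeq] at hU'; rw [← hPeq] at hU
    obtain ⟨Y, hY, rfl⟩ := mem_image.mp hU'
    obtain ⟨Z, hZ, rfl⟩ := mem_image.mp hU''
    have hY3 := mem₂ Y hY; have hZ3 := mem₃ Z hZ
    rcases mem_union.mp hU with hU | hU
    · obtain ⟨X, hX, rfl⟩ := mem_image.mp hU
      have hX3 := mem₁ X hX
      obtain ⟨h1, h2⟩ := hDD₃ X hX Y hY Z hZ
      obtain ⟨hFZ, hFX, hFY⟩ := dd_sub (B := M X) (C := M Y) (hMS Z hZ3)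
      exact cert₃ (hFZ.trans (hMS Z hZ3)) h2 h1 (hMb Z hZ3) (hMa X hX3) (hMa Y hY3) (sdiff_subset_sdiff le_rfl hFZ)
        (below (hMS X hX3) hFX) (below (hMS Y hY3) hFY) (hMa Z hZ3) (hMb X hX3) (hMb Y hY3) hFZ hFX hFY
        ⟨Z, hZ3, badM Z hZ3 (hE₃ Z hZ) hFZ⟩
    · obtain ⟨-, hyS, -, hyτ⟩ := h𝒴 U hU
      obtain ⟨hFZ, hFy, hFY⟩ := dd_sub (B := U) (C := M Y) (hMS Z hZ3)
      exact cert (hFZ.trans (hMS Z hZ3)) (hτ₃ Y hY Z hZ) (hτ Z hZ3) (hMb Z hZ3) (hMa Y hY3)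
        (sdiff_subset_sdiff le_rfl hFZ) (below (hMS Y hY3) hFY) (hMa Z hZ3) hyτ hFZ hFy
        ⟨Z, hZ3, badM Z hZ3 (hE₃ Z hZ) hFZ⟩
  have hdisj : ∀ U ∈ P₁ ∪ P₂, U ∉ R := by
    intro U hU hUR
    obtain ⟨Z, hZ, hZU⟩ := mem_image.mp hUR
    have h1 := hMa Z (mem₃ Z hZ); rw [hZU] at h1
    rw [← hPeq] at hU
    rcases mem_union.mp hU with hU | hU
    · obtain ⟨X, hX, rfl⟩ := mem_image.mp hU
      rw [hMa X (mem₁ X hX)] at h1; exact (hC₃₁ Z hZ X hX).1 (Lab.petal.inj h1).symm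
    · rw [(h𝒴 U hU).2.2.1] at h1; cases h1
  -- subfamilies of `S`
  have hfamS : ∀ D : Finset (Finset α), (∀ X ∈ D, X ∈ D₁ ∪ D₂ ∪ D₃) → ∀ U ∈ D.image M, U ⊆ S :=
    fun D hD U hU => by obtain ⟨X, hX, rfl⟩ := mem_image.mp hU; exact hMS X (hD X hX)
  have hP₁S : ∀ U ∈ P₁, U ⊆ S := fun U hU => (mem_union.mp hU).elim
    (hfamS D₁e (fun X hX => mem₁ X (hD₁e_sub X hX)) U) (fun h => (h𝒴 U h).2.1)
  have hcount := card_add_card_add_card_le_of_blocks_ordered_outer S 𝒢 P₁ P₂ Q₁ Q₂ R h𝒢S h𝒢down hP₁S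
    (hfamS D₁l (fun X hX => mem₁ X (hD₁l_sub X hX))) (fun U hU => hfamS D₂ mem₂ U (hQeq ▸ hU)) (hfamS D₃ mem₃)
    hP₁₁ hP₂₂ hP₁₂ hQ₁₁ hQ₂₂ hQ₁₂ hRR hRP₂ hPQ hQR hRP hDDP hDDR hdisj
  -- cardinalities
  have hinjM : ∀ D : Finset (Finset α), (∀ X ∈ D, X ∈ D₁ ∪ D₂ ∪ D₃) → (∀ X ∈ D, ∀ X' ∈ D, cpl X = cpl X') →
      #(D.image M) = #D := fun D hD hW => card_image_of_injOn fun X hX X' hX' hXX' => by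
    have hcc := hW X hX X' hX'
    simp only [hMdef] at hXX'
    by_cases hc : cpl X = true
    · have hc' : cpl X' = true := by rw [← hcc]; exact hc
      rw [if_pos hc, if_pos hc'] at hXX'
      rw [← Finset.sdiff_sdiff_eq_self (hXS X (hD X hX)), ← Finset.sdiff_sdiff_eq_self (hXS X' (hD X' hX')), hXX']
    · have hc' : ¬ cpl X' = true := by rw [← hcc]; exact hc
      rw [if_neg hc, if_neg hc'] at hXX'; exact hXX'
  have hcD₁ : #(D₁.image M) = #D₁ := hinjM D₁ mem₁ (fun X hX X' hX' => by rw [hE₁ X hX, hE₁ X' hX'])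
  have hcR : #R = #D₃ := hinjM D₃ mem₃ (fun X hX X' hX' => by rw [hE₃ X hX, hE₃ X' hX'])
  have hcQ₁ : #Q₁ = #D₂c := hinjM D₂c (fun X hX => mem₂ X (hD₂c_sub X hX)) (fun X hX X' hX' => by
      rw [(mem_filter.mp hX).2, (mem_filter.mp hX').2])
  have hcQ₂ : #Q₂ = #D₂p := hinjM D₂p (fun X hX => mem₂ X (hD₂p_sub X hX)) (fun X hX X' hX' => by
      rw [(mem_filter.mp hX).2, (mem_filter.mp hX').2])
  have hQdisj : Disjoint Q₁ Q₂ := Finset.disjoint_left.mpr fun U hU hU' => (hQ₁₂ U hU U hU').2 le_rfl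
  have hD₂disj : Disjoint D₂c D₂p := Finset.disjoint_left.mpr fun X hX hX' => by
    have h1 := (mem_filter.mp hX).2; rw [(mem_filter.mp hX').2] at h1; exact Bool.false_ne_true h1
  have hcQ : #(Q₁ ∪ Q₂) = #D₂ := by
    rw [card_union_of_disjoint hQdisj, hcQ₁, hcQ₂, hD₂split, card_union_of_disjoint hD₂disj]
  have hD𝒴disj : Disjoint (D₁.image M) 𝒴 := Finset.disjoint_left.mpr fun U hU hU𝒴 => by
    obtain ⟨X, hX, rfl⟩ := mem_image.mp hU
    have h := (h𝒴 _ hU𝒴).2.2.1; rw [hMa X (mem₁ X hX)] at h; cases h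
  have hcP : #(P₁ ∪ P₂) = #D₁ + #𝒴 := by rw [← hPeq, card_union_of_disjoint hD𝒴disj, hcD₁]
  have h𝒢split : #K₀ + #𝒴 = #𝒢 := by
    rw [hK₀def, h𝒴def]; exact card_filter_add_card_filter_not (fun F => f (S \ F) = top)
  have hK₀eq : K₀ = {F ∈ S.powerset | f F = bot ∧ f (S \ F) = top ∧ ∃ X ∈ D₁ ∪ D₂ ∪ D₃, X ⊆ S \ F} := by
    ext F
    rw [hK₀def, mem_filter, h𝒢, mem_filter, mem_filter]
    constructor
    · rintro ⟨⟨hFS, hbot, -, hX⟩, htop⟩; exact ⟨hFS, hbot, htop, hX⟩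
    · rintro ⟨hFS, hbot, htop, hX⟩; exact ⟨⟨hFS, hbot, Or.inl htop, hX⟩, htop⟩
  rw [← hK₀eq]
  rw [hcP, hcQ, hcR] at hcount
  omega

end OrientedAntipodalHall
end Summit.CriticalPhenomena.PercolationContinuityZ3.Theorems
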